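import Literature.Geometry.Lorentzian.HarmonicallyFlatPotential
import Literature.Geometry.Lorentzian.HarmonicallyFlatADMProofs
import Literature.Geometry.Lorentzian.PositiveMassConformal
import Literature.Geometry.Lorentzian.ConformalChange
import HarnessLib

/-!
# Conformal change by a harmonic function on a harmonically flat end: harmonic flatness of
# `φ⁴ g` and the mass drop `m̃ = m − 2c` (Bray 2001, proof of Thm. 8)

Bray, J. Differential Geom. 59 (2001) 177–267 (arXiv:math/9911173), §6, proof of Thm. 8
(`m ≥ ℰ(g)` for a manifold harmonically flat at infinity): *"consider the metric `(M³, g̃)`, with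
`g̃ = φ(x)⁴ ḡ` [`φ` the Green's function of Def. 16, harmonic, `φ → 1` in the chosen end, with
`φ(x) = 1 − ℰ/(2|x|) + O(1/|x|²)` (87)] … Then it follows … and from equations (10) and (87) that
the total mass `m̃` of `(M³, g̃)` equals `m̄ − ℰ(ḡ)`"*. This file proves that step, in the
vocabulary of `HarmonicallyFlat.lean` (Def. 1–2: `IsHarmonicallyFlatWith`, the total mass `2ab` of
Def. 2, `HasHarmonicallyFlatMass`; its agreement with the ADM energy (225),
`Bray2001_harmonicallyFlatMass_hasADMEnergy_holds`) and of `PositiveMassConformal.lean` (the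
conformal data `D.conformal φ = (φ⁴ h, k)`):

* `HasHarmonicExpansion.mul` — products of expansions `a + b/r + O(r⁻²)`;
* `AFEnd.IsHarmonicallyFlatWith.conformal` — **`φ⁴ h` is harmonically flat**: if the end `e` is
  harmonically flat for `h` beyond `R₁` with factor `𝒰` and `φ > 0` is smooth, `h`-harmonic at the
  chart points beyond `R₂` and `φ → L > 0` in the end, then `e` is harmonically flat for `φ⁴ h`
  beyond `max R₁ R₂` with factor `𝒰 · (φ ∘ Φ)` (chart metric `(φ ∘ Φ)⁴ 𝒰⁴ δ`,
  `AFEnd.hCoeff_conformal`; zero scalar curvature by the conformal law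
  `R(φ⁴h) = φ⁻⁵(R(h)φ − 8Δ_h φ)`, `scalarCurvature_conformal_fourth_power`; the factor is
  flat-harmonic by `harmonicAt_factor_mul_endValue`, `HarmonicallyFlatPotential.lean`);
* `AFEnd.IsHarmonicallyFlatWith.hasHarmonicallyFlatMass_conformal` — **the mass of `φ⁴ h`**: if
  `𝒰 = a + b₁/r + O(r⁻²)` and `φ ∘ Φ = L − c/r + O(r⁻²)`, the total mass (Def. 2) of the end for
  `φ⁴ h` is `2 (aL)(b₁ L − a c)`; for `a = L = 1` (`…_of_one`): `2b₁ − 2c = m − 2c` where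
  `m = 2b₁` is the mass for `h` — with `c = ℰ(ḡ)/2` ((87)) this is `m̃ = m̄ − ℰ(ḡ)`;
* `AFEnd.IsHarmonicallyFlatWith.hasADMEnergy_conformal_of_one` — hence the ADM energies (225):
  `E(φ⁴ h) = 2b₁ − 2c` while `E(h) = 2b₁` (`Bray2001_harmonicallyFlatMass_hasADMEnergy_holds`).

Everything is proved; there are no definitions and no named facts.

## References

* H. L. Bray, *Proof of the Riemannian Penrose inequality using the positive mass theorem*,
  J. Differential Geom. 59 (2001) 177–267, §2 Def. 1–2, (9)–(10); §6 Def. 16, (86)–(88) and the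
  proof of Thm. 8 (key `BrayRPI2001`).
* R. Schoen, S.-T. Yau, Comm. Math. Phys. 65 (1979), §2 Step 1 (the conformal law).
-/

noncomputable section

open Set Function Filter Metric Bornology Asymptotics Topology InnerProductSpace Manifold Bundle
open scoped Real ContDiff Manifold

namespace Literature.Geometry.Lorentzian

/-! ### Products of expansions -/

/-- **Products of expansions at infinity**: `(a + b/r + O(r⁻²))(a' + b'/r + O(r⁻²)) =
aa' + (ab' + ba')/r + O(r⁻²)`. [folklore] -/
theorem HasHarmonicExpansion.mul {U V : E3 → ℝ} {a b a' b' : ℝ} (hU : HasHarmonicExpansion U a b)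
    (hV : HasHarmonicExpansion V a' b') :
    HasHarmonicExpansion (fun x ↦ U x * V x) (a * a') (a * b' + b * a') := by
  have hVb : V =O[cobounded E3] (fun _ ↦ (1 : ℝ)) := hV.tendsto.isBigO_one ℝ
  have hab : (fun x : E3 ↦ a + b * ‖x‖⁻¹) =O[cobounded E3] (fun _ ↦ (1 : ℝ)) := by
    have : Tendsto (fun x : E3 ↦ a + b * ‖x‖⁻¹) (cobounded E3) (𝓝 (a + b * 0)) :=
      tendsto_const_nhds.add (HasHarmonicExpansion.tendsto_inv_norm_cobounded.const_mul b)
    exact this.isBigO_one ℝ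
  have hr2 : (fun x : E3 ↦ b * b' * (‖x‖⁻¹ * ‖x‖⁻¹)) =O[cobounded E3] fun x ↦ ‖x‖ ^ (-2 : ℝ) := by
    refine IsBigO.of_bound |b * b'| ?_
    filter_upwards [eventually_ne_cobounded (0 : E3)] with x hx
    have hx' : 0 < ‖x‖ := norm_pos_iff.2 hx
    have h2 : ‖x‖⁻¹ * ‖x‖⁻¹ = ‖x‖ ^ (-2 : ℝ) := by
      rw [Real.rpow_neg hx'.le, show (2 : ℝ) = ((2 : ℕ) : ℝ) by norm_num, Real.rpow_natCast, sq,
        mul_inv]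
    rw [h2, Real.norm_eq_abs, abs_mul, abs_of_nonneg (Real.rpow_nonneg hx'.le _),
      Real.norm_of_nonneg (Real.rpow_nonneg hx'.le _)]
  have heq : (fun x ↦ U x * V x - (a * a' + (a * b' + b * a') * ‖x‖⁻¹)) = fun x ↦
      (U x - (a + b * ‖x‖⁻¹)) * V x + (a + b * ‖x‖⁻¹) * (V x - (a' + b' * ‖x‖⁻¹))
        + b * b' * (‖x‖⁻¹ * ‖x‖⁻¹) := by
    funext x
    ring
  unfold HasHarmonicExpansion
  rw [heq]
  have h1 : (fun x ↦ (U x - (a + b * ‖x‖⁻¹)) * V x) =O[cobounded E3] fun x ↦ ‖x‖ ^ (-2 : ℝ) :=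
    (IsBigO.mul hU hVb).congr_right fun _ ↦ by simp
  have h2 : (fun x ↦ (a + b * ‖x‖⁻¹) * (V x - (a' + b' * ‖x‖⁻¹))) =O[cobounded E3]
      fun x ↦ ‖x‖ ^ (-2 : ℝ) :=
    (IsBigO.mul hab hV).congr_right fun _ ↦ by simp
  exact (h1.add h2).add hr2

/-- An expansion `L − c/r + O(r⁻²)` (the shape of Bray's (87)) is a `HasHarmonicExpansion` with
coefficients `(L, −c)`. [folklore] -/
theorem hasHarmonicExpansion_of_sub_div {F : E3 → ℝ} {L c : ℝ}
    (h : (fun x ↦ F x - (L - c / ‖x‖)) =O[cobounded E3] fun x ↦ ‖x‖ ^ (-2 : ℝ)) :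
    HasHarmonicExpansion F L (-c) :=
  h.congr_left fun x ↦ by rw [div_eq_mul_inv]; ring

/-! ### The scalar curvature of `φ⁴ h` for harmonic `φ` -/

section ScalarCurvature

variable {X : Type*} [TopologicalSpace X] [ChartedSpace E3 X] [IsManifold (𝓡 3) ∞ X]

/-- **`R(φ⁴ h) = φ⁻⁴ R(h)` where `φ` is `h`-harmonic** (Bray 2001, proof of Thm. 8, (91):
"`R̃(x) = φ(x)⁻⁵(−8Δ_ḡ + R(x)) φ(x) = φ(x)⁻⁴ R(x) > 0`"): for a smooth positive `φ` and a point
where `Δ_h φ = 0`, the conformal data `(φ⁴ h, k)` have scalar curvature `φ⁻⁴ R(h)` there; in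
particular it is nonnegative where `R(h)` is (`…_nonneg`). [cite: BrayRPI2001, §6 proof of Thm. 8, (91)] -/
theorem InitialDataSet.scalarCurvature_conformal_of_dalembertian_eq_zero (D : InitialDataSet (𝓡 3) X)
    [D.metric.HasLeviCivita] {φ : X → ℝ} (hφs : ContMDiff (𝓡 3) 𝓘(ℝ) ∞ φ) (hpos : ∀ x, 0 < φ x)
    {x : X} (hΔ : D.metric.dalembertian φ x = 0) :
    haveI := (D.conformal φ hφs hpos).metric.hasLeviCivita
    (D.conformal φ hφs hpos).metric.scalarCurvature x = (φ x ^ 4)⁻¹ * D.metric.scalarCurvature x := by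
  haveI := (D.conformal φ hφs hpos).metric.hasLeviCivita
  rw [PseudoRiemannianMetric.scalarCurvature_conformal_fourth_power D.metric
    (D.conformal φ hφs hpos).metric D.isRiemannian_metric hφs hpos
    (fun y v w ↦ D.metric_conformal_val φ hφs hpos y v w) x, hΔ]
  have hφ : φ x ≠ 0 := (hpos x).ne'
  field_simp
  ring

/-- `R(φ⁴ h) ≥ 0` where `R(h) ≥ 0` and `Δ_h φ = 0` (Bray 2001, (91)). [cite: BrayRPI2001, §6 proof of Thm. 8, (91)] -/
theorem InitialDataSet.scalarCurvature_conformal_nonneg_of_dalembertian_eq_zero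
    (D : InitialDataSet (𝓡 3) X) [D.metric.HasLeviCivita] {φ : X → ℝ}
    (hφs : ContMDiff (𝓡 3) 𝓘(ℝ) ∞ φ) (hpos : ∀ x, 0 < φ x) {x : X}
    (hΔ : D.metric.dalembertian φ x = 0) (hR : 0 ≤ D.metric.scalarCurvature x) :
    haveI := (D.conformal φ hφs hpos).metric.hasLeviCivita
    0 ≤ (D.conformal φ hφs hpos).metric.scalarCurvature x := by
  rw [D.scalarCurvature_conformal_of_dalembertian_eq_zero hφs hpos hΔ]
  exact mul_nonneg (inv_nonneg.2 (pow_nonneg (hpos x).le 4)) hR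

end ScalarCurvature

/-! ### The conformal end `φ⁴ h` -/

namespace AFEnd.IsHarmonicallyFlatWith

variable {X : Type} [TopologicalSpace X] [ChartedSpace E3 X] [IsManifold (𝓡 3) ∞ X]
  {e : AFEnd X} {D : InitialDataSet (𝓡 3) X} [D.metric.HasLeviCivita] {R₁ : ℝ} {𝒰 : E3 → ℝ}

/-- **`φ⁴ h` is harmonically flat when `φ` is a positive `h`-harmonic function with a positive
limit** (the situation of Bray's proof of Thm. 8, `g̃ = φ⁴ ḡ` with `φ` the Green's function of
Def. 16). Let `e` be harmonically flat for `D = (h, k)` beyond `R₁` with factor `𝒰`, and let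
`φ > 0` be smooth on `X`, with `Δ_h φ = 0` at the chart points `Φ y`, `‖y‖ > R₂`, and `φ → L > 0`
in the end. Then `e` is harmonically flat for the conformal data `(φ⁴ h, k)` beyond `max R₁ R₂`,
with conformal factor `𝒰 · (φ ∘ Φ)`: the chart metric is `(φ ∘ Φ)⁴ 𝒰⁴ δ` (`AFEnd.hCoeff_conformal`),
its scalar curvature vanishes by `R(φ⁴ h) = φ⁻⁵ (R(h) φ − 8 Δ_h φ) = 0`, the factor is
flat-harmonic (`harmonicAt_factor_mul_endValue`) and tends to `aL > 0`.
[cite: BrayRPI2001, §6 proof of Thm. 8 with §2 Def. 1] -/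
theorem conformal (hHF : e.IsHarmonicallyFlatWith D R₁ 𝒰) {φ : X → ℝ}
    (hφs : ContMDiff (𝓡 3) 𝓘(ℝ) ∞ φ) (hpos : ∀ x, 0 < φ x) {R₂ : ℝ}
    (hΔ : ∀ y : exteriorRegion e.R, R₂ < ‖(y : E3)‖ → D.metric.dalembertian φ (e.dataChart y) = 0)
    {L : ℝ} (hL0 : 0 < L) (hL : TendstoAtEnd e φ L) :
    haveI := (D.conformal φ hφs hpos).metric.hasLeviCivita
    e.IsHarmonicallyFlatWith (D.conformal φ hφs hpos) (max R₁ R₂) (fun y ↦ 𝒰 y * endValue e φ y) := by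
  haveI := (D.conformal φ hφs hpos).metric.hasLeviCivita
  obtain ⟨a, ha, h𝒰a⟩ := hHF.exists_tendsto
  have hφ2 : ∀ y : exteriorRegion e.R, R₂ < ‖(y : E3)‖ →
      ContMDiffAt (𝓡 3) 𝓘(ℝ, ℝ) 2 φ (e.dataChart y) :=
    fun y _ ↦ (hφs _).of_le (WithTop.coe_le_coe.mpr le_top)
  refine ⟨hHF.le_radius.trans (le_max_left _ _), fun x hx ↦ ?_, fun z hz ↦ ?_,
    ⟨a * L, mul_pos ha hL0, h𝒰a.mul hL⟩⟩
  · have hx1 : R₁ < ‖x‖ := lt_of_le_of_lt (le_max_left _ _) hx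
    have hx2 : R₂ < ‖x‖ := lt_of_le_of_lt (le_max_right _ _) hx
    have hxR : e.R < ‖x‖ := lt_of_le_of_lt hHF.le_radius hx1
    have hval : endValue e φ x = φ (e.dataChart ⟨x, hxR⟩) := endValue_of_lt e φ hxR
    refine ⟨mul_pos (hHF.pos hx1) (by rw [hval]; exact hpos _), ?_, ?_⟩
    · have hval4 : (𝒰 x * endValue e φ x) ^ 4 = φ (e.dataChart ⟨x, hxR⟩) ^ 4 * 𝒰 x ^ 4 := by
        rw [hval]
        ring
      beta_reduce
      rw [hval4, e.hCoeff_conformal D φ hφs hpos hxR, hHF.hCoeff_eq hx1, smul_smul]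
    · -- the scalar curvature of `φ⁴ h` vanishes at `Φ x`
      have hlaw := PseudoRiemannianMetric.scalarCurvature_conformal_fourth_power D.metric
        (D.conformal φ hφs hpos).metric D.isRiemannian_metric hφs hpos
        (fun y v w ↦ D.metric_conformal_val φ hφs hpos y v w) (e.dataChart ⟨x, hxR⟩)
      have hR0 : D.metric.scalarCurvature (e.dataChart ⟨x, hxR⟩) = 0 := by
        have h := hHF.scalarCurvatureCoeff_eq_zero hx1
        unfold AFEnd.scalarCurvatureCoeff at h
        rw [dif_pos hxR] at h
        exact h
      have hΔ0 : D.metric.dalembertian φ (e.dataChart ⟨x, hxR⟩) = 0 := hΔ ⟨x, hxR⟩ hx2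
      unfold AFEnd.scalarCurvatureCoeff
      rw [dif_pos hxR, hlaw, hR0, hΔ0]
      ring
  · exact hHF.harmonicAt_factor_mul_endValue hφ2 hΔ hz

/-- **The total mass of the conformal end `φ⁴ h`** (Bray 2001, proof of Thm. 8: "from equations
(10) and (87) the total mass `m̃` of `(M³, g̃)` equals `m̄ − ℰ(ḡ)`"). Under the hypotheses of
`IsHarmonicallyFlatWith.conformal`, if `𝒰 = a + b₁/r + O(r⁻²)` ((10)) and
`φ ∘ Φ = L − c/r + O(r⁻²)` ((87)), then the factor `𝒰 · (φ ∘ Φ)` of `φ⁴ h` has the expansion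
`aL + (b₁L − ac)/r + O(r⁻²)`, so the total mass of Def. 2 (`2ab`) of the end for `φ⁴ h` is
`2 (aL)(b₁L − ac)`. [cite: BrayRPI2001, §6 proof of Thm. 8 with §2 Def. 2, (10), (87)] -/
theorem hasHarmonicallyFlatMass_conformal (hHF : e.IsHarmonicallyFlatWith D R₁ 𝒰) {a b₁ : ℝ}
    (h𝒰 : HasHarmonicExpansion 𝒰 a b₁) {φ : X → ℝ} (hφs : ContMDiff (𝓡 3) 𝓘(ℝ) ∞ φ)
    (hpos : ∀ x, 0 < φ x) {R₂ : ℝ}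
    (hΔ : ∀ y : exteriorRegion e.R, R₂ < ‖(y : E3)‖ → D.metric.dalembertian φ (e.dataChart y) = 0)
    {L c : ℝ} (hL0 : 0 < L)
    (hexp : (fun x ↦ endValue e φ x - (L - c / ‖x‖)) =O[cobounded E3] fun x ↦ ‖x‖ ^ (-2 : ℝ)) :
    haveI := (D.conformal φ hφs hpos).metric.hasLeviCivita
    e.HasHarmonicallyFlatMass (D.conformal φ hφs hpos) (2 * (a * L) * (b₁ * L - a * c)) := by
  haveI := (D.conformal φ hφs hpos).metric.hasLeviCivita
  have hφexp : HasHarmonicExpansion (endValue e φ) L (-c) := hasHarmonicExpansion_of_sub_div hexp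
  have hL : TendstoAtEnd e φ L := hφexp.tendsto
  have hprod := h𝒰.mul hφexp
  exact ⟨max R₁ R₂, _, a * L, a * (-c) + b₁ * L, hHF.conformal hφs hpos hΔ hL0 hL, hprod, by ring⟩

/-- **`m̃ = m − 2c`**: in the normalisation of the chart of the end (`𝒰 → 1`, so that the mass
of Def. 2 for `h` is `m = 2b₁`, and `φ → 1`), the total mass of the end for `φ⁴ h` is `2b₁ − 2c`,
i.e. it drops by twice the monopole coefficient of `φ` — with `c = ℰ(ḡ)/2` from (87) this is
Bray's `m̃ = m̄ − ℰ(ḡ)` (proof of Thm. 8). [cite: BrayRPI2001, §6 proof of Thm. 8, (87)–(88)] -/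
theorem hasHarmonicallyFlatMass_conformal_of_one (hHF : e.IsHarmonicallyFlatWith D R₁ 𝒰) {b₁ : ℝ}
    (h𝒰 : HasHarmonicExpansion 𝒰 1 b₁) {φ : X → ℝ} (hφs : ContMDiff (𝓡 3) 𝓘(ℝ) ∞ φ)
    (hpos : ∀ x, 0 < φ x) {R₂ : ℝ}
    (hΔ : ∀ y : exteriorRegion e.R, R₂ < ‖(y : E3)‖ → D.metric.dalembertian φ (e.dataChart y) = 0)
    {c : ℝ}
    (hexp : (fun x ↦ endValue e φ x - (1 - c / ‖x‖)) =O[cobounded E3] fun x ↦ ‖x‖ ^ (-2 : ℝ)) :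
    haveI := (D.conformal φ hφs hpos).metric.hasLeviCivita
    e.HasHarmonicallyFlatMass D (2 * b₁) ∧
      e.HasHarmonicallyFlatMass (D.conformal φ hφs hpos) (2 * b₁ - 2 * c) := by
  refine ⟨⟨R₁, 𝒰, 1, b₁, hHF, h𝒰, by ring⟩, ?_⟩
  have h := hHF.hasHarmonicallyFlatMass_conformal h𝒰 hφs hpos hΔ one_pos hexp
  have h' : 2 * (1 * 1) * (b₁ * 1 - 1 * c) = 2 * b₁ - 2 * c := by ring
  rw [h'] at h
  exact h

/-- **The ADM energies: `E(h) = 2b₁` and `E(φ⁴ h) = 2b₁ − 2c`** under the hypotheses of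
`hasHarmonicallyFlatMass_conformal_of_one` (both ends are harmonically flat with factors tending
to `1`, so Def. 2 agrees with the flux limit (225), `Bray2001_harmonicallyFlatMass_hasADMEnergy_holds`).
This is the mass bookkeeping `m̃ = m̄ − ℰ(ḡ)` of Bray's proof of Thm. 8 in terms of the ADM energy
of the tree (`AFEnd.HasADMEnergy`). [cite: BrayRPI2001, §6 proof of Thm. 8, (87)–(88) with (225)] -/
theorem hasADMEnergy_conformal_of_one (hHF : e.IsHarmonicallyFlatWith D R₁ 𝒰) {b₁ : ℝ}
    (h𝒰 : HasHarmonicExpansion 𝒰 1 b₁) {φ : X → ℝ} (hφs : ContMDiff (𝓡 3) 𝓘(ℝ) ∞ φ)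
    (hpos : ∀ x, 0 < φ x) {R₂ : ℝ}
    (hΔ : ∀ y : exteriorRegion e.R, R₂ < ‖(y : E3)‖ → D.metric.dalembertian φ (e.dataChart y) = 0)
    {c : ℝ}
    (hexp : (fun x ↦ endValue e φ x - (1 - c / ‖x‖)) =O[cobounded E3] fun x ↦ ‖x‖ ^ (-2 : ℝ)) :
    haveI := (D.conformal φ hφs hpos).metric.hasLeviCivita
    e.HasADMEnergy D (2 * b₁) ∧ e.HasADMEnergy (D.conformal φ hφs hpos) (2 * b₁ - 2 * c) := by
  haveI := (D.conformal φ hφs hpos).metric.hasLeviCivita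
  obtain ⟨hm, hm'⟩ := hHF.hasHarmonicallyFlatMass_conformal_of_one h𝒰 hφs hpos hΔ hexp
  have hφexp : HasHarmonicExpansion (endValue e φ) 1 (-c) := hasHarmonicExpansion_of_sub_div hexp
  refine ⟨Bray2001_harmonicallyFlatMass_hasADMEnergy_holds X D e _ hm ⟨R₁, 𝒰, hHF, h𝒰.tendsto⟩,
    Bray2001_harmonicallyFlatMass_hasADMEnergy_holds X (D.conformal φ hφs hpos) e _ hm'
      ⟨max R₁ R₂, _, hHF.conformal hφs hpos hΔ one_pos hφexp.tendsto, ?_⟩⟩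
  have := h𝒰.tendsto.mul hφexp.tendsto
  rwa [one_mul] at this

end AFEnd.IsHarmonicallyFlatWith

end Literature.Geometry.Lorentzian

end
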